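import Summits.AtomisticToContinuum.Crystallization.Theorems.ChartedPlanarOrderNashForceBalance

/-!
# ChartedPlanarOrder — Lipschitz modulus of the LJ pair force away from the origin (`pairForce_sub_le`)

decomp-a2c lens-3 (generation 23/24; N = `Theses.ChartedPlanarOrder.ChartedZeroExcessLayered`, PS column; first ANALYTIC
brick of W_far `…TubeMonotoneSplit.FarPairStiffnessL1`: the span moduli `τ s` are Lipschitz moduli of lattice sums of
`pairForce` over far layers).

`pairForce x = (‖x‖⁻¹⁴ − ‖x‖⁻⁸) • x` (`…ProfileSlavingLJ`).  ELEMENTARY (derivative-free, no convexity needed):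
for `‖x‖, ‖y‖ ≥ t > 0`,
* `norm_invPow_smul_sub_le`: `‖ ‖x‖⁻ⁿ•x − ‖y‖⁻ⁿ•y ‖ ≤ (n+1)·t⁻ⁿ·‖x − y‖` (telescoping `|p⁻ⁿ − q⁻ⁿ|·q ≤ n t⁻ⁿ |p − q|`);
* ★ `pairForce_sub_le`: `‖pairForce x − pairForce y‖ ≤ (15 t⁻¹⁴ + 9 t⁻⁸)·‖x − y‖`;
* `pairForce_sub_le_of_inner`: the same on the half-space `{⟪ν, ·⟫ ≥ t}` of a unit vector `ν` (layer offsets);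
* `norm_pairForce_le_of_le`: `‖pairForce x‖ ≤ t⁻¹³ + t⁻⁷`.
-/

open scoped RealInnerProductSpace
open Summit.AtomisticToContinuum.Crystallization.Theorems.ChartedPlanarOrderRigidityDoor (E3)
open Summit.AtomisticToContinuum.Crystallization.Theorems.ChartedPlanarOrderProfileSlavingLJ (pairForce)
open Summit.AtomisticToContinuum.Crystallization.Theorems.ChartedPlanarOrderNashForceBalance (norm_pairForce_le)

namespace Summit.AtomisticToContinuum.Crystallization.Theorems.ChartedPlanarOrderPairForceLipschitz

/-! ## §1 Scalar telescoping -/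

/-- inverse monotonicity above a positive floor: `t ≤ p ⇒ p⁻¹ ≤ t⁻¹`. -/
theorem inv_le_inv_of_floor {p t : ℝ} (ht : 0 < t) (hp : t ≤ p) : p⁻¹ ≤ t⁻¹ :=
  inv_anti₀ ht hp

/-- inverse powers above a positive floor: `t ≤ p ⇒ p⁻ⁿ ≤ t⁻ⁿ`. -/
theorem inv_pow_le_of_floor (n : ℕ) {p t : ℝ} (ht : 0 < t) (hp : t ≤ p) : p⁻¹ ^ n ≤ t⁻¹ ^ n :=
  pow_le_pow_left₀ (inv_nonneg.2 (ht.le.trans hp)) (inv_le_inv_of_floor ht hp) n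

/-- ★ TELESCOPING: `|p⁻ⁿ − q⁻ⁿ|·q ≤ n·t⁻ⁿ·|p − q|` for `p, q ≥ t > 0`. -/
theorem abs_invPow_sub_mul_le (n : ℕ) {p q t : ℝ} (ht : 0 < t) (hp : t ≤ p) (hq : t ≤ q) :
    |p⁻¹ ^ n - q⁻¹ ^ n| * q ≤ n * t⁻¹ ^ n * |p - q| := by
  have hp0 : 0 < p := ht.trans_le hp
  have hq0 : 0 < q := ht.trans_le hq
  induction n with
  | zero => simp
  | succ n ih =>
    have hsplit : p⁻¹ ^ (n + 1) - q⁻¹ ^ (n + 1) = p⁻¹ * (p⁻¹ ^ n - q⁻¹ ^ n) + q⁻¹ ^ n * (p⁻¹ - q⁻¹) := by ring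
    have hone : |p⁻¹ - q⁻¹| * q = p⁻¹ * |p - q| := by
      rw [inv_sub_inv hp0.ne' hq0.ne', abs_div, abs_of_pos (mul_pos hp0 hq0), abs_sub_comm]
      field_simp
    have hpi : p⁻¹ ≤ t⁻¹ := inv_le_inv_of_floor ht hp
    have hqn : q⁻¹ ^ n ≤ t⁻¹ ^ n := inv_pow_le_of_floor n ht hq
    have hti : 0 ≤ t⁻¹ := inv_nonneg.2 ht.le
    have htn : 0 ≤ t⁻¹ ^ n := pow_nonneg hti n
    have hpq : 0 ≤ |p - q| := abs_nonneg _
    calc |p⁻¹ ^ (n + 1) - q⁻¹ ^ (n + 1)| * q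
        = |p⁻¹ * (p⁻¹ ^ n - q⁻¹ ^ n) + q⁻¹ ^ n * (p⁻¹ - q⁻¹)| * q := by rw [hsplit]
      _ ≤ (|p⁻¹ * (p⁻¹ ^ n - q⁻¹ ^ n)| + |q⁻¹ ^ n * (p⁻¹ - q⁻¹)|) * q :=
          mul_le_mul_of_nonneg_right (abs_add_le _ _) hq0.le
      _ = p⁻¹ * (|p⁻¹ ^ n - q⁻¹ ^ n| * q) + q⁻¹ ^ n * (|p⁻¹ - q⁻¹| * q) := by
          rw [abs_mul, abs_mul, abs_of_pos (inv_pos.2 hp0), abs_of_nonneg (pow_nonneg (inv_nonneg.2 hq0.le) n)]; ring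
      _ ≤ t⁻¹ * (n * t⁻¹ ^ n * |p - q|) + t⁻¹ ^ n * (t⁻¹ * |p - q|) := by
          rw [hone]
          exact add_le_add (mul_le_mul hpi ih (by positivity) hti)
            (mul_le_mul hqn (mul_le_mul_of_nonneg_right hpi hpq) (by positivity) htn)
      _ = ((n : ℝ) + 1) * t⁻¹ ^ (n + 1) * |p - q| := by rw [pow_succ]; ring
      _ = ((n + 1 : ℕ) : ℝ) * t⁻¹ ^ (n + 1) * |p - q| := by push_cast; ring

/-! ## §2 Vector Lipschitz bounds -/

/-- ★ `‖ ‖x‖⁻ⁿ•x − ‖y‖⁻ⁿ•y ‖ ≤ (n+1)·t⁻ⁿ·‖x − y‖` for `‖x‖, ‖y‖ ≥ t > 0`. -/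
theorem norm_invPow_smul_sub_le (n : ℕ) {x y : E3} {t : ℝ} (ht : 0 < t) (hx : t ≤ ‖x‖) (hy : t ≤ ‖y‖) :
    ‖(‖x‖⁻¹ ^ n) • x - (‖y‖⁻¹ ^ n) • y‖ ≤ (n + 1) * t⁻¹ ^ n * ‖x - y‖ := by
  have hdec : (‖x‖⁻¹ ^ n) • x - (‖y‖⁻¹ ^ n) • y = (‖x‖⁻¹ ^ n) • (x - y) + (‖x‖⁻¹ ^ n - ‖y‖⁻¹ ^ n) • y := by
    rw [smul_sub, sub_smul]; abel
  have hxn : ‖x‖⁻¹ ^ n ≤ t⁻¹ ^ n := inv_pow_le_of_floor n ht hx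
  have htn : 0 ≤ t⁻¹ ^ n := pow_nonneg (inv_nonneg.2 ht.le) n
  have h1 : ‖(‖x‖⁻¹ ^ n) • (x - y)‖ ≤ t⁻¹ ^ n * ‖x - y‖ := by
    rw [norm_smul, Real.norm_eq_abs, abs_of_nonneg (pow_nonneg (inv_nonneg.2 (norm_nonneg _)) n)]
    exact mul_le_mul_of_nonneg_right hxn (norm_nonneg _)
  have h2 : ‖(‖x‖⁻¹ ^ n - ‖y‖⁻¹ ^ n) • y‖ ≤ n * t⁻¹ ^ n * ‖x - y‖ := by
    rw [norm_smul, Real.norm_eq_abs]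
    calc |‖x‖⁻¹ ^ n - ‖y‖⁻¹ ^ n| * ‖y‖ ≤ n * t⁻¹ ^ n * |‖x‖ - ‖y‖| := abs_invPow_sub_mul_le n ht hx hy
      _ ≤ n * t⁻¹ ^ n * ‖x - y‖ := mul_le_mul_of_nonneg_left (abs_norm_sub_norm_le x y) (by positivity)
  rw [hdec]
  refine (norm_add_le _ _).trans ?_
  have := add_le_add h1 h2
  linarith

/-- the pair force as a difference of two inverse-power fields. -/
theorem pairForce_eq (x : E3) : pairForce x = (‖x‖⁻¹ ^ 14) • x - (‖x‖⁻¹ ^ 8) • x := by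
  rw [pairForce, sub_smul]

/-- ★★ LIPSCHITZ MODULUS OF THE PAIR FORCE away from the origin: `‖pairForce x − pairForce y‖ ≤ (15 t⁻¹⁴ + 9 t⁻⁸)·‖x − y‖`
for `‖x‖, ‖y‖ ≥ t > 0` (no convexity hypothesis). -/
theorem pairForce_sub_le {x y : E3} {t : ℝ} (ht : 0 < t) (hx : t ≤ ‖x‖) (hy : t ≤ ‖y‖) :
    ‖pairForce x - pairForce y‖ ≤ (15 * t⁻¹ ^ 14 + 9 * t⁻¹ ^ 8) * ‖x - y‖ := by
  have h14 := norm_invPow_smul_sub_le 14 ht hx hy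
  have h8 := norm_invPow_smul_sub_le 8 ht hx hy
  have hdec : pairForce x - pairForce y =
      ((‖x‖⁻¹ ^ 14) • x - (‖y‖⁻¹ ^ 14) • y) - ((‖x‖⁻¹ ^ 8) • x - (‖y‖⁻¹ ^ 8) • y) := by
    rw [pairForce_eq, pairForce_eq]; abel
  rw [hdec]
  refine (norm_sub_le _ _).trans ?_
  simp only [Nat.cast_ofNat] at h14 h8
  linarith

/-- the half-space form (layer offsets): for a unit vector `ν` and `⟪ν, x⟫, ⟪ν, y⟫ ≥ t > 0`. -/
theorem pairForce_sub_le_of_inner {ν x y : E3} {t : ℝ} (hν : ‖ν‖ = 1) (ht : 0 < t) (hx : t ≤ ⟪ν, x⟫) (hy : t ≤ ⟪ν, y⟫) :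
    ‖pairForce x - pairForce y‖ ≤ (15 * t⁻¹ ^ 14 + 9 * t⁻¹ ^ 8) * ‖x - y‖ := by
  have hx' : t ≤ ‖x‖ := hx.trans (by simpa [hν] using real_inner_le_norm ν x)
  have hy' : t ≤ ‖y‖ := hy.trans (by simpa [hν] using real_inner_le_norm ν y)
  exact pairForce_sub_le ht hx' hy'

/-- size of the pair force above a floor: `‖pairForce x‖ ≤ t⁻¹³ + t⁻⁷` for `‖x‖ ≥ t > 0`. -/
theorem norm_pairForce_le_of_le {x : E3} {t : ℝ} (ht : 0 < t) (hx : t ≤ ‖x‖) : ‖pairForce x‖ ≤ t⁻¹ ^ 13 + t⁻¹ ^ 7 := by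
  have hx0 : x ≠ 0 := by
    intro h; rw [h, norm_zero] at hx; exact absurd hx (not_le.2 ht)
  have h := norm_pairForce_le (x := x) (q := 0) (by simpa using hx0)
  simp only [sub_zero] at h
  exact h.trans (add_le_add (inv_pow_le_of_floor 13 ht hx) (inv_pow_le_of_floor 7 ht hx))

/-- the Lipschitz modulus is monotone in the floor: a larger floor gives a smaller modulus. -/
theorem modulus_antitone {t t' : ℝ} (ht : 0 < t) (htt' : t ≤ t') :
    15 * t'⁻¹ ^ 14 + 9 * t'⁻¹ ^ 8 ≤ 15 * t⁻¹ ^ 14 + 9 * t⁻¹ ^ 8 := by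
  have h14 := inv_pow_le_of_floor 14 ht htt'
  have h8 := inv_pow_le_of_floor 8 ht htt'
  linarith

end Summit.AtomisticToContinuum.Crystallization.Theorems.ChartedPlanarOrderPairForceLipschitz
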